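import Summits.BirchSwinnertonDyer.BirchSwinnertonDyer.Theses.PrintX8VS
import Summits.BirchSwinnertonDyer.BirchSwinnertonDyer.Theorems.SignedLowerHalvesSprungLowerDivisibilityAtThreeIotaDoorStubs
import Literature.NumberTheory.EllipticCurves.Sprung2012.SharpFlatKatoDivisibility
import Literature.NumberTheory.EllipticCurves.Sprung2012.SharpFlatColemanKatoContragredient
import Literature.NumberTheory.EllipticCurves.Sprung2012.SharpFlatSelmer
import Literature.NumberTheory.EllipticCurves.ModularCurvePeriodRatio
import HarnessLib

/-!
# Line `iota-door` (keying-honest guard) for crux `KatoSporadicPosLevelGivenHeldX8C` (item stmt-BirchSwinnertonDyer-23401,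
# route `PrintX8VS` rev 16) — skeleton v1 = the ι-DOOR PAIR of LEAD g5 (23112, child line v3) with the R♮ stub's fact binder
# RE-KEYED `h716 ↦ h716c : thm716_sharpFlatCharIdeal_divisibility_contra`

Written by the LEAD of the parent crux 19875 `SprungLowerDivisibilityAtThree` (line `chromatic-common-zeros`, lead g6, 2026-08-28),
executing director-bsd (266)'s ctl-note «re-key your skeleton to the guarded crux with the ι-door pair» on the KEYING-HONEST
successor of 23112 filed by the x8 pen at stage (A) (rev 16, 20:38Z): `KatoSporadicPosLevelGivenHeldX8C :=
thm714 → thm716_contra → period → KatoFineLowerSporadicX8 ∧ CyclotomicLowerPosLevelX8`. NOTHING HERE PROVES ANYTHING: the crux,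
K_spor, S4b-cyc, K1, leaf X8 and BSD are NOT proved.

THE LINE. The composition is the ι-door `ChromaticCommonZeros.stubs_offT_of_iotaDoor (hFα♮) (hres♮) : K_spor ∧ S4b-cyc` (p658197,
LEAD g5; conclusion = the two crux conjuncts UNFOLDED, closed BY NAME below after `intro`), fed by the SAME two stubs as the child
line v3 of 22569 / 22901 / 22570 and the pair registered on 23112 — with ONE change: the residue stub's held-fact binder `h716`
(γ-keyed `thm716_sharpFlatCharIdeal_divisibility`, false in nature at pairs with a private zero: R-250 / T67) becomes
`h716c : thm716_sharpFlatCharIdeal_divisibility_contra` (the print-faithful sibling, contra-ty p662311), exactly the antecedent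
the crux now carries. The stubs' ∀-bodies are byte-identical to v3 (F-α♮ `stub_cokerBoundIotaOffT`; R♮
`stub_katoFineLowerResidueIotaOffTC`), so every landed helper of the line applies verbatim:
* F-α♮ is REDUCED (w2 g9, p665043 `ChromaticCommonZeros.cokerBoundIotaOffT_of_massIota` + p665510 + p665840): its signature follows
  from MASS♮ on the pinned duals, itself from (M1) «chromatic excess ≤ cotorsion» (PT-exactness with the joint Coleman cokernel —
  being typed, w3 g9 lane «PT♮ TYPED») and (M2) = Matar 2020 Thm 1.1 (typed: p664557 `matar2020_thm11_selmerDualTorsion_pseudoIso_fineSelmerDual`)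
  + `Kato2004_fineSelmerDual_isTorsion`; no package field beyond `exact` is used — keying-robust;
* R♮ is the research residue (Kato 12.10 ⊆ / Sprung 7.21 ⊆ at the ι-orbits with `j(ι𝔭) < k(𝔭)`; OPEN in print at (3, a₃ = ±3)).
  What `h716c` gives it in place of `h716`'s «x ≤ k off (3)»: `h716c.invol_rational` reads `pⁿ·ι(L^•) ∈ char D` on the γ-keyed
  `D`, i.e. the fine/zeta comparison at the MIRROR prime — `x(ι𝔭)`-type bounds (dictionary p660895/p663468); the same-prime
  `x ≤ k` is no longer available from the guard (it was the false-as-typed reading).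

VACUITY UNDER THE KEYING-HONEST GUARD (LEAD g6, p666272 / p666883 `…TypedInputsInconsistent[Coprime]`): given `h714 ∧ h716c ∧ h3`
(and modularity), at every X8 pair whose Sprung pair is COPRIME (the (R0) datum `hnc`) with `μ(L♭) = 0`, `λ(L♭) ≥ 1`, `L♭(0) ≠ 0`
— the x8 ledger's commonest certified cell shape — the γ-KEYED joint package `(I, Cs, Cf, Cs.Z = Cf.Z)` over which BOTH stubs and
BOTH crux conjuncts quantify CANNOT EXIST (it would prove the typed leaf at ♭ through the squeeze (R0), which the printed Thm 7.16
refutes at the private ♭-zero): there the stubs hold VACUOUSLY. Their content is confined to the pairs where every zero of `L♭` off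
`(3), (T)` is a common zero (no private ♭-zero) — which contain all pairs with a sporadic or positive-level cyclotomic common zero,
i.e. exactly where K_spor / S4b-cyc say something. (Consistent with the x8 pen's CAVEAT on 23401: «the consequent pair keeps its
γ-keyed binders until 19875's children are re-keyed»; the print-faithful content arrives only with the C′ twin route PrintX8VSC.)

* stub F-α♮ `stub_cokerBoundIotaOffT` — the cokernel bound at the mirror prime (v3 text verbatim; shared with 22569/22901/22570/23112);
* stub R♮ `stub_katoFineLowerResidueIotaOffTC (h714) (h716c) (h3)` — `k ≤ x` on `{j(ι𝔭) < k(𝔭)}` off `(T)` behind the KEYING-HONEST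
  fact binders (v3 body verbatim; binder 2 re-keyed).
[cite: Sprung2012, Thm. 7.14 and Thm. 7.16 (p. 1504), Main Conj. 7.21 (p. 1505)] [cite: Kato2004Asterisque, Conj. 12.10 (p. 224)]
[cite: Matar2020, Thm. 1.1] [cite: Greenberg1989, §0]
-/

set_option linter.dupNamespace false
set_option autoImplicit false

noncomputable section

open scoped Classical NumberField MatrixGroups ModularForm

open NumberField IsDedekindDomain CongruenceSubgroup WeierstrassCurve Field
  Literature.NumberTheory.EllipticCurves Literature.NumberTheory.EllipticCurves.ModularForms
  Literature.NumberTheory.EllipticCurves.ZpExtension Literature.NumberTheory.EllipticCurves.Sprung2017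
  Literature.NumberTheory.EllipticCurves.Sprung2012 Literature.NumberTheory.EllipticCurves.Rank1Residual
  Literature.NumberTheory.EllipticCurves.IwasawaAlgebra Literature.NumberTheory.EllipticCurves.Kato2004
  Literature.NumberTheory.EllipticCurves.Module
  Summit.BirchSwinnertonDyer.BirchSwinnertonDyer.Theorems

namespace Summit.BirchSwinnertonDyer.BirchSwinnertonDyer.Cruxes.KatoSporadicPosLevelGivenHeldX8C

namespace IotaDoor

/-! ## The stubs (F-α♮ verbatim from the child line v3 / 23112; R♮ with the keying-honest binder `h716c`) -/

/-- **stub F-α♮ — THE COKERNEL BOUND OFF `(T)`, CARRIED AT THE MIRROR PRIME** (package currency; = hypothesis `hFα` of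
`ChromaticCommonZeros.stubs_offT_of_iotaDoor` / `katoFineLowerOffT_of_iotaDoor` VERBATIM, files `…IotaDoor[Stubs]`, LEAD g5;
SHARED verbatim by the line skeletons v3 of the three x8 children 22569 `KatoFineLowerSporadicX8`, 22901
`CyclotomicLowerPosLevelX8`, 22570 `CyclotomicLowerRestX8R` — ONE typing closes it on all three). Over the crux's own binders
(class X8, cyclotomic/Honda setting, newform and Sprung pair, the joint ♯/♭ Coleman–Kato package `I, Cs, Cf` with
`Cs.Z = Cf.Z`, a `γ`-keyed fine dual datum `Y`), at a height-one `𝔭` with `(p : Λ) ∉ 𝔭`, `T ∉ 𝔭`, at which every colour's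
Néron-normalised `L`-function vanishes: `min(ℓ_𝔭 Λ/range Cs.colMap, ℓ_𝔭 Λ/range Cf.colMap) ≤ ℓ_{ι𝔭} Y.X`,
`ι𝔭 := PrimeSpectrum.comap (invol p) 𝔭` («local index at `𝔭` ≤ fine mass at the mirror prime»). = skeleton v2's F-α
`stub_cokerBoundOffT` with ONLY the prime of the right-hand side changed (STUB-PLAN-stub_katoFineLowerSporadic v3 §C′ R1: the
same-prime F-α is not available for the ∀-bound package at `ι`-moved primes, v2 §C; F-α♮ is the typed reading of the print
composite and is branch-independent, R3). At every `ι`-FIXED prime — `(T)`, `(p)`, every positive-level cyclotomic prime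
(`ChromaticCommonZeros.comap_invol_eq_self_of_cyclotomic_comp_mem`) — F-α♮ = F-α. IN PRINT as a composite, each step exact
(x8 lit T63 (c)): (SES-KP)♯♭ — the joint Coleman map `(Col♯, Col♭) : H¹_Iw(ℚ_p, T) → Λ²` is injective (IN TREE:
`Sprung2012/ColemanMapJointInjectiveProofs`, p653370) with `T·Λ² ⊆ image` (IN TREE modulo the rank clause (IND):
`Sprung2012/ColemanMapJointCokernelProofs`, p655403; Lei–Sujatha 2021 §3; Kurihara–Pollack 2007 Prop. 1.2 for `a_p = 0`), hence
an isomorphism at every height-one `𝔭 ≠ (T)`; Poitou–Tate `0 → 𝐇¹ → H¹_Iw(ℚ_p, T) → X_{p^∞}(E/ℚ_∞) → X₀ → 0` (Kato (17.13.1);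
Kobayashi 2003 Thm. 7.3), so `tors(H¹_Iw ⧸ loc 𝐇¹) ↪ tors X_{p^∞}` with `ℓ_𝔭 tors(H¹_Iw ⧸ loc 𝐇¹) = j_gen(𝔭)` (`𝐇¹` free of
rank one, Kato Thm. 12.4 (3)); `char tors_Λ X_{p^∞} = char(X₀)^ι` (Wingberg 1989 Cor. 2.5 / Matar 2020 Thm. 1.1) — this `ι` is
the one displayed; then the dictionary to the package's `colMap` and the `γ`-keyed `Y` (STUB-PLAN v3 §C′ R3: (PT^•) per colour,
Sprung Thm. 7.14 (3), and the ♯/♭ twin H1a of `Kato2004.fineSelmerDualData_lengthAt_inv_eq`). Pure-algebra skeleton of the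
length bookkeeping: `ChromaticCommonZeros.min_lengthAt_quotient_range_le_lengthAt_torsion_of_skeleton` (p652444). HELD-INPUT
grade once typed (M to type, XL to prove from Mathlib). Why it might fail as typed: a side condition of the Poitou–Tate step at
`𝔭` (Tate lines `𝔭 = (1 + T − u^{±1})`, local `H²` at split multiplicative primes) — then restrict F-α♮ off that set and
enlarge the residue by it (`stub_katoFineLowerSporadic_of_ledgerDoor_off` pattern, p648498).
[cite: LeiSujatha2021, §3 (SES-KP), (PT)] [cite: KuriharaPollack2007, Prop. 1.2] [cite: Sprung2012, §7.1 Def. 7.1, Props. 7.3/7.6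
(p. 1500–1501), Thm. 7.14 (3) (p. 1504)] [cite: Kato2004Asterisque, Thm. 12.4 (p. 221), §17.13 (17.13.1) (p. 279–280)]
[cite: Kobayashi2003, Thm. 7.3] [cite: Wingberg1989, Cor. 2.5] [cite: Matar2020, Thm. 1.1] [cite: Greenberg1989, §0] -/
theorem stub_cokerBoundIotaOffT :
∀ (W : WeierstrassCurve ℚ) [W.IsElliptic] [W.IsGloballyMinimal] (p : ℕ) [Fact p.Prime]
      [ContinuousSMul ℤ_[p] (W.tateModule p)] [Module.Free ℤ_[p] (W.tateModule p)]
      [Module.Finite ℤ_[p] (W.tateModule p)],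
      ClassX8 W p → ∀ (κ : ZpExtension ℚ p) (γ : Field.absoluteGaloisGroup ℚ),
      κ.IsCyclotomic → κ.IsTopGenerator γ → IsCyclotomicVariable p γ →
    ∀ (v : HeightOneSpectrum (𝓞 ℚ)), (p : 𝓞 ℚ) ∈ v.asIdeal →
    ∀ (g : Field.absoluteGaloisGroup (v.adicCompletion ℚ)),
      κ.IsTopGenerator (resGalOfEmb (closureEmb (K := ℚ) (v.adicCompletion ℚ)) g) →
    ∀ (cneg : localPoints W (v.adicCompletion ℚ)) (c : ℕ → localPoints W (v.adicCompletion ℚ)),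
      IsHondaSystem κ (closureEmb (K := ℚ) (v.adicCompletion ℚ)) W (W.frobeniusTrace p) g cneg c →
    ∀ (N : ℕ) (_ : NeZero N) (f : CuspForm (Gamma0 N) 2) (ϖ : ℚ) (Lsharp Lflat : IwasawaAlgebra p),
      IsNewformOf W f → (ϖ : ℝ) * W.realPeriodRat = plusPeriod f →
      IsSprungPair f p (W.frobeniusTrace p) Lsharp Lflat →
    ∀ (I : Kato2004.IwasawaH1Data W p κ γ)
      (Cs : SharpFlatColemanKatoData W p f ϖ κ γ (closureEmb (K := ℚ) (v.adicCompletion ℚ))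
        (W.frobeniusTrace p) g c Chroma.sharp I)
      (Cf : SharpFlatColemanKatoData W p f ϖ κ γ (closureEmb (K := ℚ) (v.adicCompletion ℚ))
        (W.frobeniusTrace p) g c Chroma.flat I),
      Cs.Z = Cf.Z →
    ∀ (Y : W.FineSelmerDualData κ γ) (𝔭 : PrimeSpectrum (IwasawaAlgebra p)), 𝔭.asIdeal.height = 1 →
      (p : IwasawaAlgebra p) ∉ 𝔭.asIdeal → (PowerSeries.X : IwasawaAlgebra p) ∉ 𝔭.asIdeal →
      (∀ (col' : Chroma) (G' : IwasawaAlgebra p),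
        iwasawaToPowerSeries p G' =
          PowerSeries.C (ϖ : ℚ_[p]) * iwasawaToPowerSeries p (chromaticL col' Lsharp Lflat) →
        G' ∈ 𝔭.asIdeal) →
      min (Module.lengthAt (IwasawaAlgebra p) (IwasawaAlgebra p ⧸ LinearMap.range Cs.colMap) 𝔭)
          (Module.lengthAt (IwasawaAlgebra p) (IwasawaAlgebra p ⧸ LinearMap.range Cf.colMap) 𝔭) ≤
        Module.lengthAt (IwasawaAlgebra p) Y.X (PrimeSpectrum.comap (invol p).toRingHom 𝔭) := by
  sorry

/-- **stub R♮ — THE `ι`-RESIDUE OFF `(T)`: Kato's fine inequality `k ≤ x` at `𝔭` where the local index at the MIRROR prime is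
below the zeta index, `j(ι𝔭) < k(𝔭)`** (= hypothesis `hres` of `ChromaticCommonZeros.stubs_offT_of_iotaDoor` VERBATIM, behind
the KEYING-HONEST fact binders `h714`, `h716c` (Thm. 7.16 in PRINT keying, `_contra`), `h3` — the antecedents of crux 23401;
v3 body verbatim, binder 2 re-keyed from the γ-keyed `h716` of 22569/22901/22570/23112). Over the crux's binders, at
a height-one `𝔭` with `(p : Λ) ∉ 𝔭`, `T ∉ 𝔭`, a common zero of every normalised colour, with
`min(ℓ_{ι𝔭} Λ/range Cs.colMap, ℓ_{ι𝔭} Λ/range Cf.colMap) < ℓ_𝔭(I.H ⧸ Cs.Z)`: `ℓ_𝔭(I.H ⧸ Cs.Z) ≤ ℓ_𝔭 Y.X`. The complement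
`{k(𝔭) ≤ j(ι𝔭)}` is the `ι`-DOOR (`ChromaticCommonZeros.katoFineLowerAt_of_iotaDoor`: F-α♮ at `ι𝔭` gives `j(ι𝔭) ≤ x(𝔭)`),
which contains the ledger door `{k ≤ j}` of v2 at `ι`-fixed primes and the critic's orbit door (STUB-PLAN v3 §C′ R2) everywhere
(`zeta_le_localIndex_comap_invol_of_orbitDoor`); so R♮ ⊆ R_orb, and R♮ = v2's R at the positive-level cyclotomic primes.
Research; = the Eisenstein (⊆) half of Kato 2004 Conj. 12.10 / Sprung 2012 Main Conj. 7.21 at those primes — SPORADIC (item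
22569) and POSITIVE-LEVEL CYCLOTOMIC (item 22901, the exceptional twisted zeros `L(E, χ, 1) = 0`) alike; OPEN in print at
`(3, a₃ = ±3)` (BSTW 2024: `a_p = 0`; Kim 2026: `p ≥ 5`; Lei–Sujatha 2021 Thm. 1.2 assumes Kato's main conjecture).
Conjecturally EMPTY on the sporadic side (Kurihara–Pollack Problem 3.2 / Sprung 2015 Conj. 5.6: no sporadic common zeros; note
the hypothesis forces `k(𝔭) ≥ 1`, i.e. `𝔭` is a zero of BOTH colours with positive zeta index) and Rohrlich-finite per curve on
the cyclotomic side (none on the 217-cell census). With the binders in scope: `h716c.invol_rational` gives `pⁿ·ι(L^•) ∈ char D` on the γ-keyed `D` (mirror-prime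
bounds; the γ-keyed `h716`'s same-prime «x ≤ k off (3)» via `fine_le_zeta_of_pow_mul_mem_charIdeal`, p648387, is NOT available from this guard), the DEFECT ELEMENT `j_def ≠ 0` with `k = x + ℓ_𝔭 Λ/(j_def)`
(`ClassX8.exists_katoSporadicDefect`), so R♮ ⟺ «`j_def` has no prime factor inside `{j(ι𝔭) < k(𝔭)}` off `(T)`»; and Kato's
bound at the mirror prime `x(ι𝔭) ≤ k(ι𝔭)` (`ClassX8.fine_le_zeta_le_of_chromaticL_ne_zero` at `ι𝔭`,
`comap_invol_heightOne_not_mem`). Why it might fail: only through a failure of the signed main conjecture at such a prime of an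
X8 curve. [cite: Kato2004Asterisque, Conj. 12.10 (p. 224), Thm. 12.5 (p. 222)] [cite: Sprung2012, Thm. 7.16 (p. 1504), Prop. 7.19
and Main Conj. 7.21 (p. 1505)] [cite: KuriharaPollack2007, Problem 3.2, Thm. 1.3] [cite: Sprung2015, Conj. 5.6]
[cite: LeiSujatha2021, Thm. 1.2] [cite: Rohrlich1984, Thm.] -/
theorem stub_katoFineLowerResidueIotaOffTC (h714 : thm714_sharpFlatSelmerDual_finite_torsion)
    (h716c : thm716_sharpFlatCharIdeal_divisibility_contra) (h3 : realPeriodRat_eq_unit_mul_plusPeriod_three) :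
∀ (W : WeierstrassCurve ℚ) [W.IsElliptic] [W.IsGloballyMinimal] (p : ℕ) [Fact p.Prime]
      [ContinuousSMul ℤ_[p] (W.tateModule p)] [Module.Free ℤ_[p] (W.tateModule p)]
      [Module.Finite ℤ_[p] (W.tateModule p)],
      ClassX8 W p → ∀ (κ : ZpExtension ℚ p) (γ : Field.absoluteGaloisGroup ℚ),
      κ.IsCyclotomic → κ.IsTopGenerator γ → IsCyclotomicVariable p γ →
    ∀ (v : HeightOneSpectrum (𝓞 ℚ)), (p : 𝓞 ℚ) ∈ v.asIdeal →
    ∀ (g : Field.absoluteGaloisGroup (v.adicCompletion ℚ)),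
      κ.IsTopGenerator (resGalOfEmb (closureEmb (K := ℚ) (v.adicCompletion ℚ)) g) →
    ∀ (cneg : localPoints W (v.adicCompletion ℚ)) (c : ℕ → localPoints W (v.adicCompletion ℚ)),
      IsHondaSystem κ (closureEmb (K := ℚ) (v.adicCompletion ℚ)) W (W.frobeniusTrace p) g cneg c →
    ∀ (N : ℕ) (_ : NeZero N) (f : CuspForm (Gamma0 N) 2) (ϖ : ℚ) (Lsharp Lflat : IwasawaAlgebra p),
      IsNewformOf W f → (ϖ : ℝ) * W.realPeriodRat = plusPeriod f →
      IsSprungPair f p (W.frobeniusTrace p) Lsharp Lflat →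
    ∀ (I : Kato2004.IwasawaH1Data W p κ γ)
      (Cs : SharpFlatColemanKatoData W p f ϖ κ γ (closureEmb (K := ℚ) (v.adicCompletion ℚ))
        (W.frobeniusTrace p) g c Chroma.sharp I)
      (Cf : SharpFlatColemanKatoData W p f ϖ κ γ (closureEmb (K := ℚ) (v.adicCompletion ℚ))
        (W.frobeniusTrace p) g c Chroma.flat I),
      Cs.Z = Cf.Z →
    ∀ (Y : W.FineSelmerDualData κ γ) (𝔭 : PrimeSpectrum (IwasawaAlgebra p)), 𝔭.asIdeal.height = 1 →
      (p : IwasawaAlgebra p) ∉ 𝔭.asIdeal → (PowerSeries.X : IwasawaAlgebra p) ∉ 𝔭.asIdeal →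
      (∀ (col' : Chroma) (G' : IwasawaAlgebra p),
        iwasawaToPowerSeries p G' =
          PowerSeries.C (ϖ : ℚ_[p]) * iwasawaToPowerSeries p (chromaticL col' Lsharp Lflat) →
        G' ∈ 𝔭.asIdeal) →
      min (Module.lengthAt (IwasawaAlgebra p) (IwasawaAlgebra p ⧸ LinearMap.range Cs.colMap)
            (PrimeSpectrum.comap (invol p).toRingHom 𝔭))
          (Module.lengthAt (IwasawaAlgebra p) (IwasawaAlgebra p ⧸ LinearMap.range Cf.colMap)
            (PrimeSpectrum.comap (invol p).toRingHom 𝔭)) <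
          Module.lengthAt (IwasawaAlgebra p) (I.H ⧸ Cs.Z) 𝔭 →
      Module.lengthAt (IwasawaAlgebra p) (I.H ⧸ Cs.Z) 𝔭 ≤ Module.lengthAt (IwasawaAlgebra p) Y.X 𝔭 := by
  sorry


/-! ## The composition (sorry-free): crux 23401 BY NAME = the ι-door pair behind the keying-honest guard -/

/-- **THE SKELETON**: the crux decl `PrintX8VS.KatoSporadicPosLevelGivenHeldX8C` (item 23401) BY NAME from the two stubs — the guard's
three facts are handed to the residue stub, the ι-door composes (`ChromaticCommonZeros.stubs_offT_of_iotaDoor`, p658197), and the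
two conjuncts `KatoFineLowerSporadicX8` / `CyclotomicLowerPosLevelX8` close by unfolding. -/
theorem KatoSporadicPosLevelGivenHeldX8C_of :
    Summit.BirchSwinnertonDyer.BirchSwinnertonDyer.Theses.PrintX8VS.KatoSporadicPosLevelGivenHeldX8C := by
  intro h714 h716c h3
  refine ⟨?_, ?_⟩
  · intro W _ _ p _ _ _ _ hX
    exact (ChromaticCommonZeros.stubs_offT_of_iotaDoor stub_cokerBoundIotaOffT
      (stub_katoFineLowerResidueIotaOffTC h714 h716c h3)).1 W p hX
  · intro W _ _ p _ _ _ _ hX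
    exact (ChromaticCommonZeros.stubs_offT_of_iotaDoor stub_cokerBoundIotaOffT
      (stub_katoFineLowerResidueIotaOffTC h714 h716c h3)).2 W p hX

end IotaDoor

end Summit.BirchSwinnertonDyer.BirchSwinnertonDyer.Cruxes.KatoSporadicPosLevelGivenHeldX8C

end
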